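import Summits.CriticalPhenomena.Ising3DConformalLimit.Theorems.InversionUpgradeNormalised.Negative.DownwardRigidityWickFour
import Summits.CriticalPhenomena.Ising3DConformalLimit.Theorems.InversionUpgradeNormalised.Negative.AutomaticOrders

/-!
# `InversionUpgradeNormalised` (item stmt-CriticalPhenomena-1982): weight-`0` reflection-positive dressings are rigid

Standing crux disprover, cycle 3. A natural attempt at an RP decoy in the window is a Schur
product `S = GFF_Δ ⊙ K` (orderwise product; RP, Euclidean invariance and scale covariance are
preserved, the weight adds) with a reflection-positive, Euclidean-invariant, scale-INVARIANT
(weight `0`) "shape factor" `K` that is not inversion invariant. There is none that is continuous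
and permutation symmetric: by `two_point_eq` at `Δ = 0` the two-point function of `K` is constant,
so the one-point OS vectors of `K` are degenerate and (`osSym_row_eq_of_degenerate`) every OS row
is independent of the one-point configuration (`scaleZero_osSym_onePoint_eq`). With permutation
symmetry this reads `K₃(p,q,r) = K₃(p',q,r)` for `p, p'` below and `q, r` above the mirror
(`scaleZero_three_eq`), and after a Euclidean motion, for `p, p'` strictly separated from `q, r`
by ANY affine hyperplane (`scaleZero_three_eq_of_separated`). Hence `p ↦ K₃(p,q,r)` is locally
constant off the segment `[q,r]`, so constant there (connected complement); likewise
`K₄(·,q,r,s)` off the triangle: a continuous symmetric weight-`0` RP family is constant at each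
order, and `GFF_Δ ⊙ K` is conformally covariant again.
-/

noncomputable section

namespace Summit.CriticalPhenomena.Ising3DConformalLimit.InversionUpgradeNormalisedNegative

open Literature.Probability.LatticeModels Literature.Barriers.CriticalPhenomena
open Literature.MathematicalPhysics.QuantumFieldTheory
open Filter Set Function ScaleNotMoebius EuclideanGeometry
open scoped Topology RealInnerProductSpace

section ScaleZero

variable {τ : Fin 3}

local notation "E³" => EuclideanSpace ℝ (Fin 3)

/-- The one-point half-space configuration `(p)`. [folklore] -/
def cfg1 (p : E³) (hp : 0 < p τ) : HalfSpaceConfig 3 τ where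
  n := 1
  pts := ![p]
  injective := Function.injective_of_subsingleton _
  pos := fun i => by fin_cases i; simpa

/-- `Fin.append` of two singletons as a vector literal. [folklore] -/
theorem fin_append_one_one {α : Type*} (f g : Fin 1 → α) : Fin.append f g = ![f 0, g 0] := by
  funext i; fin_cases i <;> rfl

/-- `Fin.append` of a singleton and a pair as a vector literal. [folklore] -/
theorem fin_append_one_two {α : Type*} (f : Fin 1 → α) (g : Fin 2 → α) :
    Fin.append f g = ![f 0, g 0, g 1] := by
  funext i; fin_cases i <;> rfl

/-- `Fin.append` of a pair and a singleton as a vector literal. [folklore] -/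
theorem fin_append_two_one {α : Type*} (f : Fin 2 → α) (g : Fin 1 → α) :
    Fin.append f g = ![f 0, f 1, g 0] := by
  funext i; fin_cases i <;> rfl

/-- A weight-`0` scale-covariant Euclidean-invariant family has a CONSTANT two-point function off
the diagonal (`two_point_eq` with `Δ = 0`). [folklore] -/
theorem two_point_const_of_scaleZero {K : CorrFamily 3} (heuc : IsEuclideanInvariant K)
    (hsc : IsScaleCovariant 0 K) {a b : E³} (hab : a ≠ b) :
    K 2 ![a, b] = K 2 ![0, EuclideanSpace.single 0 1] := by
  have h := two_point_eq heuc hsc hab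
  simpa using h

/-- **`Δ = 0` rigidity, OS form.** For a reflection-positive, Euclidean-invariant, weight-`0`
scale-covariant family `K` on `ℝ³`, the OS row of a one-point configuration does not depend on the
point: `σ((p), b) = σ((p'), b)` for all `p, p'` in the half-space and every `b`. [folklore] -/
theorem scaleZero_osSym_onePoint_eq {K : CorrFamily 3} (hRP : IsReflectionPositiveAlong τ K)
    (heuc : IsEuclideanInvariant K) (hsc : IsScaleCovariant 0 K)
    {p p' : E³} (hp : 0 < p τ) (hp' : 0 < p' τ) (b : HalfSpaceConfig 3 τ) :
    osSym K (cfg1 p hp) b = osSym K (cfg1 p' hp') b := by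
  -- all one-point OS entries equal the constant `k = K₂(0, e₀)`
  have hval : ∀ {x y : E³} (hx : 0 < x τ) (hy : 0 < y τ),
      osPointKernel K (cfg1 x hx) (cfg1 y hy) = K 2 ![0, EuclideanSpace.single 0 1] := by
    intro x y hx hy
    have hne : axisReflection τ x ≠ y := by
      intro h
      have := congrArg (fun z : E³ => z τ) h
      simp only [axisReflection_apply, if_true] at this
      linarith
    show K 2 (Fin.append (fun i => axisReflection τ ((![x] : Fin 1 → E³) i)) ![y]) = _
    rw [fin_append_one_one]
    exact two_point_const_of_scaleZero heuc hsc hne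
  refine osSym_row_eq_of_degenerate hRP (cfg1 p hp) (cfg1 p' hp') b (hval hp hp) (hval hp' hp') ?_
  unfold osSym
  rw [hval hp hp', hval hp' hp]
  ring

/-- **`Δ = 0` rigidity at order three, half-space form.** With permutation symmetry the OS row IS
`K₃`: for `p, p'` strictly below the mirror `{x_τ = 0}` and `q ≠ r` strictly above it,
`K₃(p, q, r) = K₃(p', q, r)`. [folklore] -/
theorem scaleZero_three_eq {K : CorrFamily 3} (hRP : IsReflectionPositiveAlong τ K)
    (heuc : IsEuclideanInvariant K) (hsc : IsScaleCovariant 0 K) (hP : IsPermutationSymmetric K)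
    {p p' q r : E³} (hp : p τ < 0) (hp' : p' τ < 0) (hq : 0 < q τ) (hr : 0 < r τ) (hqr : q ≠ r) :
    K 3 ![p, q, r] = K 3 ![p', q, r] := by
  have hθp : 0 < (axisReflection τ p) τ := by simp; linarith
  have hθp' : 0 < (axisReflection τ p') τ := by simp; linarith
  have key := scaleZero_osSym_onePoint_eq hRP heuc hsc hθp hθp' (cfg2 q r hq hr hqr)
  -- unfold both OS rows: the `(θθp, q, r)` entry and the `(θq, θr, θp)` entry
  have hrefl : IsReflectionInvariantAlong τ K := fun n x => heuc.2 n (axisReflection τ) x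
  have row : ∀ {x : E³} (hx : 0 < (axisReflection τ x) τ),
      osSym K (cfg1 (axisReflection τ x) hx) (cfg2 q r hq hr hqr) = K 3 ![x, q, r] := by
    intro x hx
    -- second entry: `K₃(θq, θr, θx) = K₃(q, r, x) = K₃(x, q, r)`
    have h2 : K 3 ![axisReflection τ q, axisReflection τ r, axisReflection τ x] = K 3 ![x, q, r] := by
      have e1 : (![axisReflection τ q, axisReflection τ r, axisReflection τ x] : Fin 3 → E³) =
          fun i => axisReflection τ ((![q, r, x] : Fin 3 → E³) i) := by
        funext i; fin_cases i <;> rfl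
      rw [e1, hrefl]
      -- cyclic permutation
      have e2 : (![q, r, x] : Fin 3 → E³) = (![x, q, r] : Fin 3 → E³) ∘ (finRotate 3) := by
        funext i; fin_cases i <;> rfl
      rw [e2, hP]
    show (K 3 (Fin.append (fun i => axisReflection τ ((![axisReflection τ x] : Fin 1 → E³) i)) ![q, r])
      + K 3 (Fin.append (fun i => axisReflection τ ((![q, r] : Fin 2 → E³) i)) ![axisReflection τ x])) / 2
      = _
    rw [fin_append_one_two, fin_append_two_one]
    show (K 3 ![axisReflection τ (axisReflection τ x), q, r]
      + K 3 ![axisReflection τ q, axisReflection τ r, axisReflection τ x]) / 2 = _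
    rw [axisReflection_axisReflection, h2]
    ring
  rwa [row hθp, row hθp'] at key

/-- **`Δ = 0` rigidity at order three, invariant form.** If `p` and `p'` are strictly separated
from `q ≠ r` by an affine hyperplane (`⟪p,w⟫, ⟪p',w⟫ < c < ⟪q,w⟫, ⟪r,w⟫` for a unit vector `w`),
then `K₃(p,q,r) = K₃(p',q,r)`: translate the hyperplane to `c = 0` and rotate `w` onto `e_τ`
(`Submodule.reflection_sub`). Consequently `p ↦ K₃(p,q,r)` is locally constant off the segment
`[q,r]`, hence constant there (its complement in `ℝ³` is connected): a continuous, symmetric,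
Euclidean-invariant, weight-`0`, reflection-positive family is constant at order three (and, by
the same separation argument applied to `K₄(·, q, r, s)` off the triangle, at order four) — the
Schur product `GFF ⊙ K` with such a `K` is again conformally covariant. [folklore] -/
theorem scaleZero_three_eq_of_separated {K : CorrFamily 3} (τ : Fin 3)
    (hRP : IsReflectionPositiveAlong τ K)
    (heuc : IsEuclideanInvariant K) (hsc : IsScaleCovariant 0 K) (hP : IsPermutationSymmetric K)
    {p p' q r w : E³} {c : ℝ} (hw : ‖w‖ = 1) (hp : ⟪p, w⟫ < c) (hp' : ⟪p', w⟫ < c)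
    (hq : c < ⟪q, w⟫) (hr : c < ⟪r, w⟫) (hqr : q ≠ r) :
    K 3 ![p, q, r] = K 3 ![p', q, r] := by
  set e : E³ := EuclideanSpace.single τ 1 with he
  have he1 : ‖e‖ = 1 := by simp [he]
  -- an isometry `R` with `R w = e`
  obtain ⟨R, hRw⟩ : ∃ R : E³ ≃ₗᵢ[ℝ] E³, R w = e := by
    by_cases hwe : w = e
    · exact ⟨LinearIsometryEquiv.refl ℝ E³, by simp [hwe]⟩
    · exact ⟨Submodule.reflection (ℝ ∙ (w - e))ᗮ, Submodule.reflection_sub (by rw [hw, he1])⟩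
  -- the Euclidean motion `x ↦ R (x - c w)`; its `τ`-coordinate is `⟪x, w⟫ - c`
  have hcoord : ∀ x : E³, (R (x - c • w)) τ = ⟪x, w⟫ - c := by
    intro x
    have h1 : (R (x - c • w)) τ = ⟪R (x - c • w), e⟫ := by
      rw [he, EuclideanSpace.inner_single_right]; simp
    rw [h1, ← hRw, LinearIsometryEquiv.inner_map_map, inner_sub_left, real_inner_smul_left,
      real_inner_self_eq_norm_sq, hw]
    ring
  have hmove : ∀ x y z : E³, K 3 ![x, y, z] = K 3 ![R (x - c • w), R (y - c • w), R (z - c • w)] := by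
    intro x y z
    calc K 3 ![x, y, z] = K 3 (fun i => (![x, y, z] : Fin 3 → E³) i + -(c • w)) :=
          (heuc.1 3 (-(c • w)) ![x, y, z]).symm
      _ = K 3 (fun i => R ((fun j => (![x, y, z] : Fin 3 → E³) j + -(c • w)) i)) := (heuc.2 3 R _).symm
      _ = K 3 ![R (x - c • w), R (y - c • w), R (z - c • w)] := by
          congr 1
          funext i; fin_cases i <;> simp [sub_eq_add_neg]
  rw [hmove p q r, hmove p' q r]
  refine scaleZero_three_eq hRP heuc hsc hP ?_ ?_ ?_ ?_ ?_
  · rw [hcoord]; linarith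
  · rw [hcoord]; linarith
  · rw [hcoord]; linarith
  · rw [hcoord]; linarith
  · intro h
    exact hqr (sub_left_injective (R.injective h))

end ScaleZero

end Summit.CriticalPhenomena.Ising3DConformalLimit.InversionUpgradeNormalisedNegative

end
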